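import Mathlib
import Summits.NavierStokesRegularity.NavierStokesRegularity.Theses.EulerZoomLiouville
import Summits.NavierStokesRegularity.NavierStokesRegularity.Theorems.EulerZoomLiouvillePowerGaugeEulerLiouvilleLargeRho
import Summits.NavierStokesRegularity.NavierStokesRegularity.Theorems.EulerZoomLiouvillePowerGaugeEulerLiouvilleSwirlCapacityVelocityFloor
import Summits.NavierStokesRegularity.NavierStokesRegularity.Theorems.EulerZoomLiouvillePowerGaugeEulerLiouvilleSwirlCapacityTransport
import Summits.NavierStokesRegularity.NavierStokesRegularity.Theorems.EulerZoomLiouvillePowerGaugeEulerLiouvilleSwirlCapacityEndgame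
import Literature.Analysis.FluidPDE.AxisymmetricEuler
import Literature.Analysis.FluidPDE.ClassicalSolution
import Literature.Analysis.FluidPDE.VectorCalculus
import HarnessLib.Audit

/-!
# Line `swirl-capacity` (ideator ns-idea-11 g3, lens «complete» = program-completion) for the crux
# `EulerZoomLiouville.PowerGaugeEulerLiouville` (stmt-NavierStokesRegularity-19832)

HONEST KINSHIP FIRST: this is the SWIRL SIBLING of `casimir-floor` (LINE A of this generation; its K1 transport and K2 floor have meanwhile
LANDED: `…CasimirFloorTransport`, `…CasimirFloor.casimirFloor`).  It shares with LINE A the transport kit (backward particle flow under the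
drift bound `‖u(τ)‖_∞ ≤ M(−τ)^{−κ}`, drift radius `M|τ|^{1−κ}/(1−κ)`), the presence-tax endgame against the E-gauge
`∫∫_{Q_a}|∇u|² ≤ c a^{1−ρ}` and the SAME exponent race `κ > (1−ρ)/(2−ρ)` (kernel-checked again below).  What is NEW is the Casimir and the
floor, and with them the POPULATION: every stratum typed on this crux so far (L1, LINE A, mirror-moment, birth's concentrating strata) is
SWIRL-FREE; here the members carry SWIRL.

THE SWIRL CASIMIR.  For classical axisymmetric Euler the swirl `Γ = r u_θ = x₀u₁ − x₁u₀` (`swirl`, junk-free, `= 0` on the axis) is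
MATERIALLY CONSERVED by the full flow — Kelvin's theorem on material circles (Majda–Bertozzi §2.3.3 eq. (2.67), `D̃/Dt (r v^θ) = 0`,
[corpus:book:majda2002-vorticity-incompressible-flow p.58]; tree fact `swirl_transport` with `ν = 0`).  So superlevel blobs
`{|Γ| ≥ γ₀}` keep their level AND their volume backward (D1) — no supremum bookkeeping, no axis trouble.

THE NEW LEVER (D2 = `AxisCapacityFloor`, pure analysis, one slice): an axisymmetric `C¹` scalar `f` vanishing on the axis with `f ≥ γ₀` on a
measurable `T ⊆ B(0,A)` of volume `≥ V` has
`∫_{B(0,3A)} |∇f|² / r² dx ≥ K γ₀² / (A (1 + log⁺(A³/V)))`  (universal `K > 0`).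
WHY (2D LOGARITHMIC CAPACITY PINNED BY THE AXIS): in meridional variables `∫|∇f|²/r² dx = 2π ∬ |∇'f|²/r dr dz`, a planar Dirichlet energy with
weight `1/r ≥ 1/(3A)`; `f` must climb from `0` on the axis to `γ₀` on the section `T'` (flat area `≥ V/(2πA)` after axisymmetrising `T`); by
flux duality (Cauchy–Schwarz against an explicit unit flux field: planar Newtonian spreading from the uniform measure on `T'` out to distance `A`,
then horizontal rays into the axis where `f = 0` kills the boundary term; tangential on the arc `|x| = 3A`) the energy is
`≥ γ₀² / (flow energy)`, and the flow energy is `≤ C·A·(1 + log⁺(A/d_eff))`, `πd_eff² =` flat area, by the bathtub bound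
`∫_{T'} log(1/|y−y'|)dy' ≤` its value on the equal-area disc.  The logarithm — not a power of `V` — is the 2D signature and is exactly what
the race tolerates.  AXISYMMETRY IS ESSENTIAL: a non-symmetric ball of volume `V` at distance `a` costs only `≈ 4πγ₀²V^{1/3}/a²` (3D capacity);
a torus costs `≈ 4π²γ₀²/(a log(8a/d))`.  (A 1D radial Hardy/ray argument gives only `γ₀²V/A⁴` — useless; this is why the lever is new.)
For the velocity: `|∇Γ|² ≤ 4 r² ‖∇v‖_F²` pointwise for axisymmetric `C¹` `v` (differentiate `v(R_θ x) = R_θ v(x)` at `θ = 0`: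
`∇v(x)(r e_θ) = (−v₁, v₀, 0)`, so the zeroth-order term of `∇Γ = x₀∇v₁ − x₁∇v₀ + (v₁, −v₀, 0)` is `≤ r‖∇v‖`), whence D2' = `SwirlCapacityFloor`
for `∫_{B(3A)} ‖∇v‖_F²` — the integrand of the landed window lemma `setLIntegral_window_frobenius_fderiv_le`.

ENDGAME (D3): a member of the stratum with swirl somewhere (`Γ(t₀,x) ≠ 0`) has a blob `B(x,δ)` with `|Γ| ≥ γ₀ > 0`, volume `V`; by D1 its avatars
at `τ < t₀` sit in `B(0, C₀ + M|τ|^{1−κ}/(1−κ))` with the same level and volume; at window scale `a`: present (inside `B(0,a/3)`) for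
`|τ| ≲ a^{1/(1−κ)}` (or the whole window if `κ ≥ 1/2`), each present slice paying `≥ Kγ₀²/((a/3)(1+log⁺(a³/27V)))`, total `≳ a^{min(2,1/(1−κ))−1}/log a`
versus `≤ c a^{1−ρ}`: absurd iff `min(2, 1/(1−κ)) > 2−ρ` iff `κ > (1−ρ)/(2−ρ)` (`exponent_race`).  So: SLOW-DRIFTING CLASSICAL AXISYMMETRIC MEMBERS ARE
SWIRL-FREE — and the swirl-free ones are LINE A's.  Union of the two strata = all classical axisymmetric members with `κ > (1−ρ)/(2−ρ)`.
Residue D4 (non-classical / non-axisymmetric / fast drift `κ ≤ (1−ρ)/(2−ρ)` / swirl-free) is the crux minus the stratum, OPEN, NOT claimed.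

LABEL (idea-crit-8 g2 V29, 2026-08-28T08:19Z, PASS-WITH-PRICE stratum-grade; prices P1–P4 paid in this revision, decl bodies UNCHANGED):
P1 — book this line as «the swirling slow-drift stratum of 19832 is empty»; width on crux 19832 outside the κ-window = 0 (D4); N0 / NS
untouched.  SCOPE, plainly — IN: any classical axisymmetric swirling member whose sup-speed decays backward at least like `|t|^{−κ}` with `κ` in
the window `((1−ρ)/(2−ρ), 1)`, INCLUDING bounded-profile self-similar / DSS-rate envelopes (tree convention `selfSimilarCollapse (1/(2+ρ))`:
`κ_ss = (1+ρ)/(2+ρ) ∈ (1/2, 3/5]`, and `(1+ρ)/(2+ρ) − (1−ρ)/(2−ρ) = 2ρ/(4−ρ²) > 0`, so the scaling-critical envelope lies INSIDE the window;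
for EXACTLY self-similar swirling profiles the kill is already Chae CMP 2007 «Note added», what this line adds is envelope-only hypotheses);
OUT: spatially unbounded or backward non-decaying speeds (steady / travelling, `κ = 0` — other landed files' business), `κ ≤ (1−ρ)/(2−ρ)`,
anything non-classical / non-axisymmetric (all in D4).  P2 — NO new seat: D2' → D1 → D3 are re-instantiations of LANDED files
(`…AxisymNoSwirl.timeDerivWithin_swirl_eq_neg` in AxisymSwirlTransport for `DΓ/Dt = 0`; `…CasimirFloorTransport` flow kit;
`…CasimirFloorEndgame.vanishesAE_of_casimirFloor_of_blobsPersist` + `…CasimirFloorEndgameTools`) and belong to the same 19832 casimir prover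
as a follow-on; D2 is the only new mathematics and the only real cost; D4 zero width; order D2' → D1 → D3 → D2 (D2 LAST: it is true, the risk
is Lean cost, not falsity).  P3 — COST OF D2 WITH AN ESCAPE HATCH: the log-sharp floor needs 2D condenser potential theory absent from Mathlib
(flux field + divergence theorem on the meridional half-disc with the axis as grounded side + log-kernel bathtub) ⇒ size L in Lean, not M+;
but the race is strict for every fixed member, so the POWER-LOSSY family
`D2_θ : ∀ θ ∈ (0,θ₀], ∃ K_θ > 0, ∫_{B(3A)}|∇f|²/r² ≥ K_θ γ₀² (V/A³)^θ / A`
wins the same race (take `3θ < min(2,1/(1−κ)) − (2−ρ)`) with the SAME threshold and is Mathlib-reachable (2D Gagliardo–Nirenberg–Sobolev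
`MeasureTheory.eLpNorm_le_eLpNorm_fderiv_of_eq_inner` at `p = 2q/(q+2)` + Hölder on the box + ray-Poincaré from the grounded axis + odd
reflection/cut-off); if D2-log stalls, the prover retargets D2/D2'/D3 to `D2_θ` (a reshaped skeleton under this slug) without touching D1,
D4 or the threshold.  P4 — see the hygiene note on `Sig.stub_swirlEndgame`.

REV 2 (ideator, same slug, 2026-08-28 ~08:50Z) — STATE OF PLAY + THE P3 ESCAPE HATCH TYPED.  Within twenty minutes of filing, provers LANDED
D1 (`…Theorems.PowerGaugeEulerLiouville.SwirlCapacity.swirlBlobsPersist_of_axiDriftingWith`, file `…SwirlCapacityTransport`), D2'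
(`….swirlCapacityFloor_of_axisCapacityFloor`, `…SwirlCapacityVelocityFloor`) and D3 (`….vanishesAE_of_swirlCapacityFloor_of_swirlBlobsPersist`,
`…SwirlCapacityEndgame`), all sorry-free; below, the stubs D1/D2'/D3 are therefore DISCHARGED by those tree theorems (no sorry) and stay in
the file only as the record of the cut.  OPEN: D2 (the log-sharp lever, size L in Lean) and the residue D4.  NEW IN REV 2 (decl bodies of rev 1
unchanged): the SQUARE-LOG FALLBACK, which the race tolerates just as well (any sub-power loss does) and which IS Mathlib-reachable —
`AxisCapacityFloorSq` / `SwirlCapacityFloorSq` = the same floors with `(1 + log⁺(A³/V))²`, the stubs D2sq (`stub_axisCapacityFloorSq`, M+)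
and D3sq (`stub_swirlEndgameSq : AxisCapacityFloorSq → endgame`, M−: the landed D2' and D3 proofs re-run with the squared logarithm —
`1 + log⁺(2x) ≤ (1+log 2)(1+log⁺ x)` squared, and `a^e (log a)² < c a^s` eventually), the proved monotonicity `axisCapacityFloorSq_of_axisCapacityFloor`
(log-sharp ⇒ square-log), and the compositions re-cut to the OPEN stubs: PRIMARY `PowerGaugeEulerLiouville_of : D2sq → D3sq → D4 → crux`
(D1 through its tree theorem), `PowerGaugeEulerLiouville_of_log : D2 → D4 → crux` (D1, D2', D3 through their tree theorems), and the rev-1 cut kept as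
`PowerGaugeEulerLiouville_of_rev1`.  So the line now closes on EITHER D2 OR D2sq + D3sq (plus the residue).
PLAN FOR D2sq (all Mathlib): (i) MERIDIONAL REDUCTION — `F (r,z) := f (r e₀ + z e₂)` is `C¹` on `ℝ²`, even in `r`, `F(0,·) = 0`, and
`∫_{B(3A)} ‖∇f‖²/r² dx = 2π ∬_{half-disc(3A)} ‖∇F‖²/r dr dz` (cylindrical coordinates = `polarCoord` × `id` through
`EuclideanSpace ℝ (Fin 3) ≃ᵐ (ℝ × ℝ) × ℝ`, `lintegral_comp_polarCoord_symm`; the `θ`-integrand is constant by axisymmetry); by the same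
change of variables `vol T = ∫_θ ∬ 1_T r dr dz`, so SOME half-plane `θ₀` carries `∬_{T'_{θ₀}} r dr dz ≥ V/(2π)` (averaging; `T'_{θ₀}` is a
measurable preimage), hence `area(T'_{θ₀}) ≥ V/(2πA)` and `F ≥ γ₀` on it.  (ii) CUT-OFF WITH HARDY — `G := χ(|y|/A)·F` with `χ = 1` on `[0,1]`,
`0` beyond `2`, `|χ'| ≤ 2`: the error `∬ F²|∇χ|²/r ≤ (4/A²)∬_{A<|y|<2A} F²/r ≤ 4·∬_{half-disc(3A)}‖∇F‖²/r` by the RAY HARDY inequality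
`F(r,z)² ≤ (r²/2)∫₀^r |∂_r F|²/r'` (Cauchy–Schwarz from `F(0,z) = 0`; rays at `|z| < 2A` stay inside the half-disc), so
`W := ∬ ‖∇G‖²/|r| ≤ 10 ∬_{half-disc(3A)} ‖∇F‖²/r`.  (iii) GNS + HÖLDER — Mathlib's Gagliardo–Nirenberg–Sobolev
`MeasureTheory.eLpNorm_le_eLpNorm_fderiv_of_eq_inner` on `ℝ²` with `p = 2q/(q+2) ∈ [1,2)`, `p* = q`, whose constant
`eLpNormLESNormFDerivOfEqInnerConst μ p = C₁ · p(n−1)/(n−p) = C₁ · q/2` is EXPLICIT and linear in `q`; Hölder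
`‖∇G‖_p ≤ W^{1/2} (∬_{|y|<6A} |r|^{q/2})^{1/q} ≤ W^{1/2} (6A)^{1/2 + 2/q} π^{1/q}`; and `‖G‖_q ≥ γ₀ α^{1/q}`, `α = area(T'_{θ₀})`.  Together:
`W ≥ c γ₀² (α/A²)^{2/q} / (q² A)`.  (iv) OPTIMISE — `q := max (2, 2 log (36πA²/α))` gives `(α/A²)^{2/q} ≥ e^{−1}/36π` and
`W ≥ c' γ₀² / (A (1 + log⁺(A³/V))²)` (use `α ≥ V/(2πA)`).  Every step is first-year analysis over existing Mathlib API; the only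
book-keeping is `ENNReal`/`eLpNorm` plumbing.  (The log-SHARP D2 needs `C ~ √q`, i.e. Trudinger–Moser, or condenser potential theory —
neither in Mathlib; hence L.)
No summit is proved by a line.
-/

open MeasureTheory Set Filter Topology Metric
open scoped ENNReal NNReal
open Literature.Analysis Literature.Analysis.FluidPDE

set_option linter.dupNamespace false

namespace Summit.NavierStokesRegularity.NavierStokesRegularity.Cruxes.PowerGaugeEulerLiouville.SwirlCapacity

/-- Local abbreviation: ℝ³. -/
abbrev E3 : Type := EuclideanSpace ℝ (Fin 3)

/-- Membership in Seregin's power-gauged ancient Euler class — verbatim the three hypotheses of the crux (same as `Birth.InClass`). -/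
@[reducible] def InClass (ρ : ℝ) (u : ℝ → E3 → E3) (p : ℝ → E3 → ℝ) (H : ℝ → E3 → E3 →L[ℝ] E3)
    (c : ℝ≥0) : Prop :=
  IsSuitableWeakSolutionOn (slab (EuclideanSpace ℝ (Fin 3)) (Set.Iio 0) isOpen_Iio) 0 0 u p ∧
    HasWeakSpatialGradientOn (slab (EuclideanSpace ℝ (Fin 3)) (Set.Iio 0) isOpen_Iio) u H ∧
    (∀ a : ℝ, 0 < a →
      ENNReal.ofReal (a ^ (2 * ρ)) * cknA a (0 : ℝ × E3) u + ENNReal.ofReal (a ^ ρ) * cknE a (0 : ℝ × E3) H +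
        ENNReal.ofReal (a ^ (2 * ρ)) * cknD a (0 : ℝ × E3) p ≤ (c : ℝ≥0∞))

/-- The conclusion of the crux: `u` vanishes a.e. on the past slab. -/
@[reducible] def VanishesAE (u : ℝ → E3 → E3) : Prop :=
  Function.uncurry u =ᵐ[volume.restrict (Set.Iio (0 : ℝ) ×ˢ (Set.univ : Set E3))] 0

/-- Backward drift radius of the velocity bound `‖u(s,·)‖_∞ ≤ M (−s)^{−κ}` between times `t₁ < t₀ < 0` (`κ < 1`) — same formula as LINE A. -/
noncomputable def driftRadius (M κ t₀ t₁ : ℝ) : ℝ :=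
  M / (1 - κ) * ((-t₁) ^ (1 - κ) - (-t₀) ^ (1 - κ))

/-- Classical AXISYMMETRIC member (swirl ALLOWED) with drift data `(M, κ)`: classical Euler on `(−∞,0) × ℝ³`, axisymmetric velocity and
pressure slices, `0 ≤ M`, `κ < 1`, `‖u(τ,x)‖ ≤ M(−τ)^{−κ}`.  (= LINE A's `IsSwirlFreeDriftingWith` with `HasNoSwirl` DROPPED and the — automatic
for classical axisymmetric solutions — axisymmetry of `p` recorded.) -/
def IsAxiDriftingWith (u : ℝ → E3 → E3) (p : ℝ → E3 → ℝ) (M κ : ℝ) : Prop :=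
  IsClassicalEulerSolutionOn (Set.Iio 0) 0 u p ∧
    (∀ τ : ℝ, τ < 0 → IsAxisymmetric (u τ) ∧ IsAxisymmetricScalar (p τ)) ∧
    0 ≤ M ∧ κ < 1 ∧ ∀ τ : ℝ, τ < 0 → ∀ x : E3, ‖u τ x‖ ≤ M * (-τ) ^ (-κ)

/-- The member carries swirl somewhere in the past. -/
def HasPastSwirl (u : ℝ → E3 → E3) : Prop :=
  ∃ τ₀ : ℝ, τ₀ < 0 ∧ ∃ x : E3, swirl (u τ₀) x ≠ 0

/-- THE STRATUM: slow-drifting (`κ > (1−ρ)/(2−ρ)`) classical axisymmetric members WITH swirl. -/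
def IsSwirlingSlowDrifting (ρ : ℝ) (u : ℝ → E3 → E3) (p : ℝ → E3 → ℝ) : Prop :=
  ∃ M κ : ℝ, (1 - ρ) / (2 - ρ) < κ ∧ IsAxiDriftingWith u p M κ ∧ HasPastSwirl u

/-- SWIRL BLOBS PERSIST BACKWARD (conclusion shape of D1): a late off-axis blob `B(x₀,δ)` at time `t₀ < 0` on which `|Γ| ≥ γ₀` has, at each earlier
time `t₁`, a measurable avatar `T ⊆ B(0, ‖x₀‖ + δ + driftRadius)` on which `|Γ| ≥ γ₀` still, of at least the same volume (in truth: the backward flow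
image, `Γ` transported, volume equal). -/
def SwirlBlobsPersist (u : ℝ → E3 → E3) (M κ : ℝ) : Prop :=
  ∀ t₀ : ℝ, t₀ < 0 → ∀ (x₀ : E3) (δ γ₀ : ℝ), 0 < δ → δ < cylRadius x₀ →
    (∀ x ∈ ball x₀ δ, γ₀ ≤ |swirl (u t₀) x|) →
    ∀ t₁ : ℝ, t₁ < t₀ →
      ∃ T : Set E3, MeasurableSet T ∧ T ⊆ ball (0 : E3) (‖x₀‖ + δ + driftRadius M κ t₀ t₁) ∧
        (∀ x ∈ T, γ₀ ≤ |swirl (u t₁) x|) ∧ volume (ball x₀ δ) ≤ volume T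

/-- THE AXIS CAPACITY FLOOR (the new lever; pure real analysis, no PDE): an axisymmetric `C¹` scalar vanishing on the symmetry axis that is
`≥ γ₀` on a measurable `T ⊆ B(0,A)` of volume `≥ V` has weighted Dirichlet energy `∫_{B(0,3A)} |∇f|²/r² ≥ K γ₀² / (A (1 + log⁺ (A³/V)))` for a
universal `K > 0` (2D logarithmic capacity of the meridional section, pinned by the zero boundary value on the axis). -/
def AxisCapacityFloor : Prop :=
  ∃ K : ℝ, 0 < K ∧ ∀ (f : E3 → ℝ) (T : Set E3) (A V γ₀ : ℝ), ContDiff ℝ 1 f → IsAxisymmetricScalar f →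
    (∀ x : E3, cylRadius x = 0 → f x = 0) → 0 < A → 0 < V → 0 < γ₀ → MeasurableSet T → T ⊆ ball (0 : E3) A →
    ENNReal.ofReal V ≤ volume T → (∀ x ∈ T, γ₀ ≤ f x) →
      ENNReal.ofReal (K * γ₀ ^ 2 / (A * (1 + max 0 (Real.log (A ^ 3 / V))))) ≤
        ∫⁻ x in ball (0 : E3) (3 * A), ENNReal.ofReal (‖fderiv ℝ f x‖ ^ 2 / cylRadius x ^ 2)

/-- THE SWIRL CAPACITY FLOOR (velocity form, what the endgame consumes): for an axisymmetric `C¹` field `v`, a measurable `T ⊆ B(0,A)` of volume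
`≥ V` on which `|Γ| = |swirl v| ≥ γ₀` forces `∫_{B(0,3A)} ‖∇v‖_F² ≥ K γ₀² / (A (1 + log⁺(A³/V)))`. -/
def SwirlCapacityFloor : Prop :=
  ∃ K : ℝ, 0 < K ∧ ∀ (v : E3 → E3) (T : Set E3) (A V γ₀ : ℝ), ContDiff ℝ 1 v → IsAxisymmetric v →
    0 < A → 0 < V → 0 < γ₀ → MeasurableSet T → T ⊆ ball (0 : E3) A →
    ENNReal.ofReal V ≤ volume T → (∀ x ∈ T, γ₀ ≤ |swirl v x|) →
      ENNReal.ofReal (K * γ₀ ^ 2 / (A * (1 + max 0 (Real.log (A ^ 3 / V))))) ≤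
        ∫⁻ x in ball (0 : E3) (3 * A), ENNReal.ofReal (frobeniusNormSq (fderiv ℝ v x))

/-- SQUARE-LOG AXIS CAPACITY FLOOR (rev 2 fallback for D2; Mathlib-reachable via 2D Gagliardo–Nirenberg–Sobolev with the explicit constant
`C₁·q/2`, Hölder, ray Hardy and the choice `q ≈ 2 log(A²/α)` — plan in the module docstring): as `AxisCapacityFloor` with the logarithm SQUARED. -/
def AxisCapacityFloorSq : Prop :=
  ∃ K : ℝ, 0 < K ∧ ∀ (f : E3 → ℝ) (T : Set E3) (A V γ₀ : ℝ), ContDiff ℝ 1 f → IsAxisymmetricScalar f →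
    (∀ x : E3, cylRadius x = 0 → f x = 0) → 0 < A → 0 < V → 0 < γ₀ → MeasurableSet T → T ⊆ ball (0 : E3) A →
    ENNReal.ofReal V ≤ volume T → (∀ x ∈ T, γ₀ ≤ f x) →
      ENNReal.ofReal (K * γ₀ ^ 2 / (A * (1 + max 0 (Real.log (A ^ 3 / V))) ^ 2)) ≤
        ∫⁻ x in ball (0 : E3) (3 * A), ENNReal.ofReal (‖fderiv ℝ f x‖ ^ 2 / cylRadius x ^ 2)

/-- SQUARE-LOG SWIRL CAPACITY FLOOR (velocity form of `AxisCapacityFloorSq`; follows from it exactly as D2' followed from D2). -/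
def SwirlCapacityFloorSq : Prop :=
  ∃ K : ℝ, 0 < K ∧ ∀ (v : E3 → E3) (T : Set E3) (A V γ₀ : ℝ), ContDiff ℝ 1 v → IsAxisymmetric v →
    0 < A → 0 < V → 0 < γ₀ → MeasurableSet T → T ⊆ ball (0 : E3) A →
    ENNReal.ofReal V ≤ volume T → (∀ x ∈ T, γ₀ ≤ |swirl v x|) →
      ENNReal.ofReal (K * γ₀ ^ 2 / (A * (1 + max 0 (Real.log (A ^ 3 / V))) ^ 2)) ≤
        ∫⁻ x in ball (0 : E3) (3 * A), ENNReal.ofReal (frobeniusNormSq (fderiv ℝ v x))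

/-- Log-sharp implies square-log (the denominator only grows: `1 + log⁺ ≥ 1`). -/
theorem axisCapacityFloorSq_of_axisCapacityFloor : AxisCapacityFloor → AxisCapacityFloorSq := by
  rintro ⟨K, hK, h⟩
  refine ⟨K, hK, ?_⟩
  intro f T A V γ₀ hf hax h0 hA hV hγ hT hTA hvol hlev
  refine le_trans ?_ (h f T A V γ₀ hf hax h0 hA hV hγ hT hTA hvol hlev)
  apply ENNReal.ofReal_le_ofReal
  have hL : 1 ≤ 1 + max 0 (Real.log (A ^ 3 / V)) := by
    have := le_max_left 0 (Real.log (A ^ 3 / V)); linarith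
  have hnum : 0 ≤ K * γ₀ ^ 2 := by positivity
  have hden : 0 < A * (1 + max 0 (Real.log (A ^ 3 / V))) := by positivity
  rw [div_le_div_iff₀ (by positivity) hden]
  have : A * (1 + max 0 (Real.log (A ^ 3 / V))) ≤ A * (1 + max 0 (Real.log (A ^ 3 / V))) ^ 2 := by
    have h1 : (1 + max 0 (Real.log (A ^ 3 / V))) ≤ (1 + max 0 (Real.log (A ^ 3 / V))) ^ 2 := by nlinarith
    exact mul_le_mul_of_nonneg_left h1 hA.le
  exact mul_le_mul_of_nonneg_left this hnum

/-! ## Registered stub signatures -/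

/-- Signature of `stub_swirlBlobTransport` (D1, size M): classical axisymmetric members with drift data `(M,κ)`, `κ < 1`, have persistent swirl
blobs — the SAME flow kit as LINE A's landed K1 (`ledgerBlobsPersist_of_swirlFreeDriftingWith`: localised particle flow, backward displacement
`≤ driftRadius`, `det Dφ = 1` + change of variables for the volume), with `Γ ∘ φ = Γ` (material conservation of the swirl, Majda–Bertozzi (2.67);
tree fact `swirl_transport` at `ν = 0`, `f = 0`, via `IsClassicalEulerSolutionOn ↔ IsClassicalNSSolutionOn … 0`) replacing `(ω_θ/r) ∘ φ`. -/
def Sig.stub_swirlBlobTransport : Prop :=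
  ∀ (u : ℝ → E3 → E3) (p : ℝ → E3 → ℝ) (M κ : ℝ), IsAxiDriftingWith u p M κ → SwirlBlobsPersist u M κ

/-- Signature of `stub_axisCapacityFloor` (D2, size M+: THE NEW LEVER; proof sketch in the module docstring — meridional reduction, flux duality,
bathtub bound for the logarithmic kernel). -/
def Sig.stub_axisCapacityFloor : Prop := AxisCapacityFloor

/-- Signature of `stub_swirlCapacityFloor` (D2', size S/M−): the velocity form follows from D2 applied to `±swirl v` — `contDiff_swirl`,
`IsAxisymmetric.isAxisymmetricScalar_swirl`, `swirl_eq_zero_of_cylRadius_eq_zero`, the sign split (one of `T ∩ {Γ ≥ γ₀}`, `T ∩ {Γ ≤ −γ₀}` has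
volume `≥ V/2`), and the pointwise bound `‖∇Γ‖² ≤ 4 r² ‖∇v‖_F²` (from `∇v(x)(r e_θ) = (−v₁, v₀, 0)` for axisymmetric `v`). -/
def Sig.stub_swirlCapacityFloor : Prop := AxisCapacityFloor → SwirlCapacityFloor

/-- Signature of `stub_swirlEndgame` (D3, size M): GIVEN the floor, in the window `0 < ρ ≤ 1/2`, a member with drift data `(M,κ)`,
`(1−ρ)/(2−ρ) < κ`, persistent swirl blobs and swirl somewhere is trivial (in truth: impossible) — continuity blob around the swirl point
(`C¹` slice), D1 avatars inside `B(0,a/3)` for `|τ| ≲ a^{1/(1−κ)}`, floor per present slice, summed against the landed window bound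
`setLIntegral_window_frobenius_fderiv_le`; race `exponent_race`; `M = 0` forces `u = 0` directly.
HYGIENE (critic P4, no retyping): the contradiction runs on the a.e. PRESENT SLICES `τ < τ₀` inside the window `(−a², 0)` (Tonelli on the
window lintegral; a null set of bad slices is discarded), and the weak gradient `H` of `InClass` is identified with `fderiv ℝ (u τ)` a.e. by
the landed window lemma itself (`weakGradient_ae_eq_fderiv_of_classical` inside `setLIntegral_window_frobenius_fderiv_le`), so the floor D2'
(stated for `fderiv`) is applied slice-wise with no retyping of `H`. -/
def Sig.stub_swirlEndgame : Prop :=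
  SwirlCapacityFloor →
    ∀ ρ : ℝ, 0 < ρ → ρ ≤ 1 / 2 → ∀ (u : ℝ → E3 → E3) (p : ℝ → E3 → ℝ) (H : ℝ → E3 → E3 →L[ℝ] E3) (c : ℝ≥0),
      InClass ρ u p H c → ∀ M κ : ℝ, (1 - ρ) / (2 - ρ) < κ → IsAxiDriftingWith u p M κ → HasPastSwirl u →
        SwirlBlobsPersist u M κ → VanishesAE u

/-- Signature of `stub_axisCapacityFloorSq` (D2sq, rev 2, size M+, Mathlib-reachable — THE FALLBACK LEVER): the square-log axis capacity
floor.  Plan (module docstring): meridional reduction by `polarCoord`, cut-off with the ray Hardy inequality, Mathlib GNS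
`eLpNorm_le_eLpNorm_fderiv_of_eq_inner` in `ℝ²` with its explicit constant `C₁·q/2`, Hölder, `q ≈ 2 log(A²/α)`. -/
def Sig.stub_axisCapacityFloorSq : Prop := AxisCapacityFloorSq

/-- Signature of `stub_swirlEndgameSq` (D3sq, rev 2, size M−): the endgame from the SQUARE-LOG axis floor — the landed D2' proof
(`swirlCapacityFloor_of_axisCapacityFloor`, constant `K/(4(1+log 2)²)`) and the landed D3 proof
(`vanishesAE_of_swirlCapacityFloor_of_swirlBlobsPersist`, with `a^e (log a)²` in place of `a^e log a` in `eventually_dominates`) re-run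
verbatim; the race `exponent_race` is strict, so the extra logarithm is absorbed. -/
def Sig.stub_swirlEndgameSq : Prop :=
  AxisCapacityFloorSq →
    ∀ ρ : ℝ, 0 < ρ → ρ ≤ 1 / 2 → ∀ (u : ℝ → E3 → E3) (p : ℝ → E3 → ℝ) (H : ℝ → E3 → E3 →L[ℝ] E3) (c : ℝ≥0),
      InClass ρ u p H c → ∀ M κ : ℝ, (1 - ρ) / (2 - ρ) < κ → IsAxiDriftingWith u p M κ → HasPastSwirl u →
        SwirlBlobsPersist u M κ → VanishesAE u

/-- Signature of `stub_nonSwirlingRest` (D4, OPEN, crux-sized — NOT claimed by this line): in the window `0 < ρ ≤ 1/2`, members OUTSIDE the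
stratum (non-classical, non-axisymmetric, fast drift `κ ≤ (1−ρ)/(2−ρ)`, or swirl-free — the last being LINE A's business) are trivial. -/
def Sig.stub_nonSwirlingRest : Prop :=
  ∀ ρ : ℝ, 0 < ρ → ρ ≤ 1 / 2 → ∀ (u : ℝ → E3 → E3) (p : ℝ → E3 → ℝ) (H : ℝ → E3 → E3 →L[ℝ] E3) (c : ℝ≥0),
    InClass ρ u p H c → ¬ IsSwirlingSlowDrifting ρ u p → VanishesAE u

/-! ## Stubs -/

/-- STUB D1 — LANDED 2026-08-28 (`…SwirlCapacityTransport`), discharged here by the tree theorem (no sorry). -/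
theorem stub_swirlBlobTransport : Sig.stub_swirlBlobTransport :=
  Summit.NavierStokesRegularity.NavierStokesRegularity.Theorems.PowerGaugeEulerLiouville.SwirlCapacity.swirlBlobsPersist_of_axiDriftingWith

/-- STUB D2 [OPEN, provable, L in Lean — the log-sharp lever; D2sq below is the Mathlib-reachable fallback that closes the line equally]. -/
theorem stub_axisCapacityFloor : Sig.stub_axisCapacityFloor := by
  sorry

/-- STUB D2' — LANDED 2026-08-28 (`…SwirlCapacityVelocityFloor`), discharged here by the tree theorem (no sorry). -/
theorem stub_swirlCapacityFloor : Sig.stub_swirlCapacityFloor :=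
  Summit.NavierStokesRegularity.NavierStokesRegularity.Theorems.PowerGaugeEulerLiouville.SwirlCapacity.swirlCapacityFloor_of_axisCapacityFloor

/-- STUB D3 — LANDED 2026-08-28 (`…SwirlCapacityEndgame`), discharged here by the tree theorem (no sorry). -/
theorem stub_swirlEndgame : Sig.stub_swirlEndgame :=
  Summit.NavierStokesRegularity.NavierStokesRegularity.Theorems.PowerGaugeEulerLiouville.SwirlCapacity.vanishesAE_of_swirlCapacityFloor_of_swirlBlobsPersist

/-- STUB D2sq [OPEN, provable, M+, Mathlib-reachable — rev 2 fallback lever]. -/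
theorem stub_axisCapacityFloorSq : Sig.stub_axisCapacityFloorSq := by
  sorry

/-- STUB D3sq [OPEN, provable, M− — landed D2' + D3 proofs re-run with the squared logarithm]. -/
theorem stub_swirlEndgameSq : Sig.stub_swirlEndgameSq := by
  sorry

/-- STUB D4 [OPEN residue, not claimed]. -/
theorem stub_nonSwirlingRest : Sig.stub_nonSwirlingRest := by
  sorry

/-! ## Race bookkeeping (kernel-checked) -/

/-- The stratum threshold lies below `1/2` for every `ρ ∈ (0,2)`. -/
theorem threshold_lt_half {ρ : ℝ} (hρ : 0 < ρ) (hρ2 : ρ < 2) : (1 - ρ) / (2 - ρ) < 1 / 2 := by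
  rw [div_lt_div_iff₀ (by linarith) (by norm_num)]
  linarith

/-- THE EXPONENT RACE: presence `a^{1/(1−κ)}` times floor `a^{−1}` beats the E-gauge `a^{1−ρ}` iff `κ > (1−ρ)/(2−ρ)`. -/
theorem exponent_race {ρ κ : ℝ} (hκ : κ < 1) (hρ2 : ρ < 2) :
    2 - ρ < 1 / (1 - κ) ↔ (1 - ρ) / (2 - ρ) < κ := by
  have h1 : 0 < 1 - κ := by linarith
  have h2 : 0 < 2 - ρ := by linarith
  rw [lt_div_iff₀ h1, div_lt_iff₀ h2]
  constructor <;> intro h <;> nlinarith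

/-- The zeroth-order identity behind `‖∇Γ‖ ≤ 2r‖∇v‖`: the swirl is the pairing of `v` with the rotation generator `J x = (−x₁, x₀, 0)`,
`Γ(x) = x₀ v₁ − x₁ v₀`; in particular it vanishes on the axis (tree lemma, re-derived). -/
theorem swirl_axis (v : E3 → E3) {x : E3} (hx : cylRadius x = 0) : swirl v x = 0 :=
  swirl_eq_zero_of_cylRadius_eq_zero v hx

/-! ## Composition -/

/-- **PRIMARY COMPOSITION (rev 2; kernel-checked, no sorry of its own): the OPEN stubs of the square-log route — D2sq, D3sq and the
residue D4 — give the crux BY NAME**; D1 enters through its landed tree theorem.  (The log-sharp alternative is `PowerGaugeEulerLiouville_of_log`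
below: D2 and D4 alone also give the crux, through the landed D1, D2', D3.) -/
theorem PowerGaugeEulerLiouville_of :
    Sig.stub_axisCapacityFloorSq → Sig.stub_swirlEndgameSq → Sig.stub_nonSwirlingRest →
      Summit.NavierStokesRegularity.NavierStokesRegularity.Theses.EulerZoomLiouville.PowerGaugeEulerLiouville := by
  intro h2 h3 h4 ρ hρ u p H c hsw hH hc
  by_cases hhalf : 1 / 2 < ρ
  · exact
      Summit.NavierStokesRegularity.NavierStokesRegularity.Theorems.PowerGaugeEulerLiouville.powerGaugeEulerLiouville_largeRho
        ρ hhalf u p H c hsw hH hc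
  · have hρ2 : ρ ≤ 1 / 2 := not_lt.mp hhalf
    by_cases hS : IsSwirlingSlowDrifting ρ u p
    · obtain ⟨M, κ, hκ, hW, hsw'⟩ := hS
      exact h3 h2 ρ hρ hρ2 u p H c ⟨hsw, hH, hc⟩ M κ hκ hW hsw' (stub_swirlBlobTransport u p M κ hW)
    · exact h4 ρ hρ hρ2 u p H c ⟨hsw, hH, hc⟩ hS

/-- **Composition, log-sharp route as cut in rev 1 (kernel-checked): the five original stubs give the crux BY NAME** (D1, D2', D3 are now
tree theorems, see the discharged stubs above). -/
theorem PowerGaugeEulerLiouville_of_rev1 :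
    Sig.stub_swirlBlobTransport → Sig.stub_axisCapacityFloor → Sig.stub_swirlCapacityFloor → Sig.stub_swirlEndgame →
      Sig.stub_nonSwirlingRest →
      Summit.NavierStokesRegularity.NavierStokesRegularity.Theses.EulerZoomLiouville.PowerGaugeEulerLiouville := by
  intro h1 h2 h2' h3 h4 ρ hρ u p H c hsw hH hc
  by_cases hhalf : 1 / 2 < ρ
  · exact
      Summit.NavierStokesRegularity.NavierStokesRegularity.Theorems.PowerGaugeEulerLiouville.powerGaugeEulerLiouville_largeRho
        ρ hhalf u p H c hsw hH hc
  · have hρ2 : ρ ≤ 1 / 2 := not_lt.mp hhalf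
    by_cases hS : IsSwirlingSlowDrifting ρ u p
    · obtain ⟨M, κ, hκ, hW, hsw'⟩ := hS
      exact h3 (h2' h2) ρ hρ hρ2 u p H c ⟨hsw, hH, hc⟩ M κ hκ hW hsw' (h1 u p M κ hW)
    · exact h4 ρ hρ hρ2 u p H c ⟨hsw, hH, hc⟩ hS

/-- **OPEN-ONLY, log-sharp route (kernel-checked): the log-sharp lever D2 and the residue D4 give the crux** — D1, D2', D3 are tree
theorems.  Landing EITHER `stub_axisCapacityFloor` (this route) OR `stub_axisCapacityFloorSq` + `stub_swirlEndgameSq` (primary route)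
reduces the line to its declared residue D4. -/
theorem PowerGaugeEulerLiouville_of_log :
    Sig.stub_axisCapacityFloor → Sig.stub_nonSwirlingRest →
      Summit.NavierStokesRegularity.NavierStokesRegularity.Theses.EulerZoomLiouville.PowerGaugeEulerLiouville :=
  fun h2 h4 => PowerGaugeEulerLiouville_of_rev1 stub_swirlBlobTransport h2 stub_swirlCapacityFloor stub_swirlEndgame h4

end Summit.NavierStokesRegularity.NavierStokesRegularity.Cruxes.PowerGaugeEulerLiouville.SwirlCapacity
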